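import Summits.CriticalPhenomena.SAWScalingLimit.Theorems.CriticalBubbleBound.Negative.CriticalBubbleBoundSubcritical

/-!
# Negative-side results for the crux `SAWTotalPositivity.CriticalBubbleBound` (stmt-CriticalPhenomena-7117):
certified lower bound on any admissible constant: `C ≥ 0.5405` (kernel-checked walk lists, certified `μ ≤ 2.7`; axiom-clean `≥ 0.4449`) and numerics (work-file §8).

Refuter `cdisprove` (standing adversary); the full indexed work file is
`Summits/CriticalPhenomena/SAWScalingLimit/Cruxes/CriticalBubbleBound/Disproof.lean`.
-/

noncomputable section

open MeasureTheory Filter Topology Set Function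
open Literature.Probability.LatticeModels Literature.Probability.Percolation
open Literature.Probability.RandomPlanarGeometry Literature.Probability.RandomPlanarGeometry.SAW
open Literature.Barriers.CriticalPhenomena.SupercriticalSAW
open scoped ENNReal NNReal BigOperators

namespace Summit.CriticalPhenomena.SAWScalingLimit.Theorems.CriticalBubbleBound.Negative

open Summit.CriticalPhenomena.SAWScalingLimit.Theses.SAWTotalPositivity (CriticalBubbleBound)

/-! ## §8 Tightness from below: a certified lower bound on ANY admissible constant; numerics -/

/-- The 1 self-avoiding vertex lists of the 1-step SAWs `0 → e₀` of `ℤ²`. [folklore] -/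
def lists1 : List (List (Site 2)) :=
  [ [![0, 0], ![1, 0]] ]

/-- The 2 self-avoiding vertex lists of the 3-step SAWs `0 → e₀` of `ℤ²`. [folklore] -/
def lists3 : List (List (Site 2)) :=
  [ [![0, 0], ![0, 1], ![1, 1], ![1, 0]],
    [![0, 0], ![0, -1], ![1, -1], ![1, 0]] ]

/-- The 6 self-avoiding vertex lists of the 5-step SAWs `0 → e₀` of `ℤ²`. [folklore] -/
def lists5 : List (List (Site 2)) :=
  [ [![0, 0], ![-1, 0], ![-1, 1], ![0, 1], ![1, 1], ![1, 0]],
    [![0, 0], ![-1, 0], ![-1, -1], ![0, -1], ![1, -1], ![1, 0]],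
    [![0, 0], ![0, 1], ![1, 1], ![2, 1], ![2, 0], ![1, 0]],
    [![0, 0], ![0, 1], ![0, 2], ![1, 2], ![1, 1], ![1, 0]],
    [![0, 0], ![0, -1], ![1, -1], ![2, -1], ![2, 0], ![1, 0]],
    [![0, 0], ![0, -1], ![0, -2], ![1, -2], ![1, -1], ![1, 0]] ]

/-- The 28 self-avoiding vertex lists of the 7-step SAWs `0 → e₀` of `ℤ²`. [folklore] -/
def lists7 : List (List (Site 2)) :=
  [ [![0, 0], ![-1, 0], ![-2, 0], ![-2, 1], ![-1, 1], ![0, 1], ![1, 1], ![1, 0]],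
    [![0, 0], ![-1, 0], ![-2, 0], ![-2, -1], ![-1, -1], ![0, -1], ![1, -1], ![1, 0]],
    [![0, 0], ![-1, 0], ![-1, 1], ![0, 1], ![1, 1], ![2, 1], ![2, 0], ![1, 0]],
    [![0, 0], ![-1, 0], ![-1, 1], ![0, 1], ![0, 2], ![1, 2], ![1, 1], ![1, 0]],
    [![0, 0], ![-1, 0], ![-1, 1], ![-1, 2], ![0, 2], ![1, 2], ![1, 1], ![1, 0]],
    [![0, 0], ![-1, 0], ![-1, 1], ![-1, 2], ![0, 2], ![0, 1], ![1, 1], ![1, 0]],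
    [![0, 0], ![-1, 0], ![-1, -1], ![0, -1], ![1, -1], ![2, -1], ![2, 0], ![1, 0]],
    [![0, 0], ![-1, 0], ![-1, -1], ![0, -1], ![0, -2], ![1, -2], ![1, -1], ![1, 0]],
    [![0, 0], ![-1, 0], ![-1, -1], ![-1, -2], ![0, -2], ![1, -2], ![1, -1], ![1, 0]],
    [![0, 0], ![-1, 0], ![-1, -1], ![-1, -2], ![0, -2], ![0, -1], ![1, -1], ![1, 0]],
    [![0, 0], ![0, 1], ![1, 1], ![2, 1], ![3, 1], ![3, 0], ![2, 0], ![1, 0]],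
    [![0, 0], ![0, 1], ![1, 1], ![2, 1], ![2, 0], ![2, -1], ![1, -1], ![1, 0]],
    [![0, 0], ![0, 1], ![1, 1], ![1, 2], ![2, 2], ![2, 1], ![2, 0], ![1, 0]],
    [![0, 0], ![0, 1], ![-1, 1], ![-1, 2], ![0, 2], ![1, 2], ![1, 1], ![1, 0]],
    [![0, 0], ![0, 1], ![-1, 1], ![-1, 0], ![-1, -1], ![0, -1], ![1, -1], ![1, 0]],
    [![0, 0], ![0, 1], ![0, 2], ![1, 2], ![2, 2], ![2, 1], ![1, 1], ![1, 0]],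
    [![0, 0], ![0, 1], ![0, 2], ![1, 2], ![2, 2], ![2, 1], ![2, 0], ![1, 0]],
    [![0, 0], ![0, 1], ![0, 2], ![1, 2], ![1, 1], ![2, 1], ![2, 0], ![1, 0]],
    [![0, 0], ![0, 1], ![0, 2], ![0, 3], ![1, 3], ![1, 2], ![1, 1], ![1, 0]],
    [![0, 0], ![0, -1], ![1, -1], ![2, -1], ![3, -1], ![3, 0], ![2, 0], ![1, 0]],
    [![0, 0], ![0, -1], ![1, -1], ![2, -1], ![2, 0], ![2, 1], ![1, 1], ![1, 0]],
    [![0, 0], ![0, -1], ![1, -1], ![1, -2], ![2, -2], ![2, -1], ![2, 0], ![1, 0]],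
    [![0, 0], ![0, -1], ![-1, -1], ![-1, 0], ![-1, 1], ![0, 1], ![1, 1], ![1, 0]],
    [![0, 0], ![0, -1], ![-1, -1], ![-1, -2], ![0, -2], ![1, -2], ![1, -1], ![1, 0]],
    [![0, 0], ![0, -1], ![0, -2], ![1, -2], ![2, -2], ![2, -1], ![1, -1], ![1, 0]],
    [![0, 0], ![0, -1], ![0, -2], ![1, -2], ![2, -2], ![2, -1], ![2, 0], ![1, 0]],
    [![0, 0], ![0, -1], ![0, -2], ![1, -2], ![1, -1], ![2, -1], ![2, 0], ![1, 0]],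
    [![0, 0], ![0, -1], ![0, -2], ![0, -3], ![1, -3], ![1, -2], ![1, -1], ![1, 0]] ]

/-- Decidable certificate that a vertex list is an `n`-step SAW of `ℤ²` from `0` to `e₀`. [folklore] -/
def IsShortCert (n : ℕ) (l : List (Site 2)) : Prop :=
  l ≠ [] ∧ l.IsChain (zdGraph 2).Adj ∧ l.Nodup ∧ l.length = n + 1 ∧ l.head? = some 0 ∧
    l.getLast? = some e₀

/-- The certificate is decidable (lattice adjacency, `Nodup`, lengths and endpoints are). [folklore] -/
instance instDecidableIsShortCert (n : ℕ) (l : List (Site 2)) : Decidable (IsShortCert n l) := by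
  unfold IsShortCert; infer_instance

/-- A certified list is a member of the tree's `Zd.pathsAt 2 n e₀`. [folklore] -/
theorem mem_pathsAt_of_isShortCert {n : ℕ} {l : List (Site 2)} (h : IsShortCert n l) :
    l ∈ Zd.pathsAt 2 n e₀ :=
  Zd.mem_pathsAt_iff.2 ⟨⟨h.1, h.2.1, h.2.2.1⟩, h.2.2.2.1, h.2.2.2.2.1, h.2.2.2.2.2⟩

/-- All listed walks are genuine (kernel-checked by `decide`). [folklore] -/
theorem lists_cert :
    (∀ l ∈ lists1, IsShortCert 1 l) ∧ (∀ l ∈ lists3, IsShortCert 3 l) ∧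
      (∀ l ∈ lists5, IsShortCert 5 l) ∧ (∀ l ∈ lists7, IsShortCert 7 l) := by
  unfold lists1 lists3 lists5 lists7 IsShortCert e₀
  decide

/-- The lists are pairwise distinct. [folklore] -/
theorem lists_nodup : lists1.Nodup ∧ lists3.Nodup ∧ lists5.Nodup ∧ lists7.Nodup := by
  unfold lists1 lists3 lists5 lists7; decide

/-- Lower bound on a two-point count from a certified duplicate-free list of walks. [folklore] -/
theorem le_countAt_of_lists {n : ℕ} {L : List (List (Site 2))} (hL : L.Nodup)
    (hcert : ∀ l ∈ L, IsShortCert n l) : L.length ≤ Zd.countAt 2 n e₀ := by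
  classical
  rw [← Zd.card_pathsAt, ← List.toFinset_card_of_nodup hL]
  exact Finset.card_le_card fun l hl => mem_pathsAt_of_isShortCert (hcert l (List.mem_toFinset.1 hl))

/-- **Certified counts** `c_1(e₀) ≥ 1`, `c_3(e₀) ≥ 2`, `c_5(e₀) ≥ 6`, `c_7(e₀) ≥ 28` (these are the
exact values `(m/2)·p_m`, `p_4 = 1, p_6 = 2, p_8 = 7`; equality is not needed). [cite: MadrasSlade1993, §1.1 (Table 1.1)] -/
theorem countAt_lower_bounds :
    1 ≤ Zd.countAt 2 1 e₀ ∧ 2 ≤ Zd.countAt 2 3 e₀ ∧ 6 ≤ Zd.countAt 2 5 e₀ ∧ 28 ≤ Zd.countAt 2 7 e₀ := by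
  obtain ⟨c1, c3, c5, c7⟩ := lists_cert
  obtain ⟨d1, d3, d5, d7⟩ := lists_nodup
  exact ⟨le_countAt_of_lists d1 c1, le_countAt_of_lists d3 c3, le_countAt_of_lists d5 c5,
    le_countAt_of_lists d7 c7⟩

/-- The first four odd terms bound the bubble from below:
`G_{x_c}(0,e₀) ≥ x_c + 2 x_c³ + 6 x_c⁵ + 28 x_c⁷`. [folklore] -/
theorem poly_le_bubble :
    ENNReal.ofReal (criticalFugacity + 2 * criticalFugacity ^ 3 + 6 * criticalFugacity ^ 5 +
      28 * criticalFugacity ^ 7) ≤ bubble e₀ := by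
  classical
  have hx := criticalFugacity_pos_lt_one'.1.le
  rw [bubble, latticeKernel_zero_eq_tsum_countAt]
  set f : ℕ → ℝ≥0∞ := fun n => (Zd.countAt 2 n e₀ : ℝ≥0∞) * ENNReal.ofReal (criticalFugacity ^ n)
  have hterm : ∀ (n k : ℕ), k ≤ Zd.countAt 2 n e₀ →
      ENNReal.ofReal ((k : ℝ) * criticalFugacity ^ n) ≤ f n := by
    intro n k hk
    simp only [f]
    rw [ENNReal.ofReal_mul (Nat.cast_nonneg _), ENNReal.ofReal_natCast]
    exact mul_le_mul_of_nonneg_right (by exact_mod_cast hk) zero_le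
  obtain ⟨c1, c3, c5, c7⟩ := countAt_lower_bounds
  have hS : ({1, 3, 5, 7} : Finset ℕ).sum f ≤ ∑' n, f n := ENNReal.sum_le_tsum _
  refine le_trans ?_ hS
  rw [Finset.sum_insert (by decide), Finset.sum_insert (by decide), Finset.sum_insert (by decide),
    Finset.sum_singleton]
  calc ENNReal.ofReal (criticalFugacity + 2 * criticalFugacity ^ 3 + 6 * criticalFugacity ^ 5 +
        28 * criticalFugacity ^ 7)
      = ENNReal.ofReal ((1 : ℕ) * criticalFugacity ^ 1) + ENNReal.ofReal ((2 : ℕ) * criticalFugacity ^ 3) +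
          ENNReal.ofReal ((6 : ℕ) * criticalFugacity ^ 5) + ENNReal.ofReal ((28 : ℕ) * criticalFugacity ^ 7) := by
        rw [← ENNReal.ofReal_add (by positivity) (by positivity),
          ← ENNReal.ofReal_add (by positivity) (by positivity),
          ← ENNReal.ofReal_add (by positivity) (by positivity)]
        congr 1; push_cast; ring
    _ ≤ f 1 + f 3 + f 5 + f 7 := by
        gcongr
        · exact hterm 1 1 c1
        · exact hterm 3 2 c3
        · exact hterm 5 6 c5
        · exact hterm 7 28 c7
    _ = f 1 + (f 3 + (f 5 + f 7)) := by ring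

/-- **CERTIFIED LOWER BOUND ON THE CONSTANT.** Any `C` witnessing `CriticalBubbleBound` satisfies
`C ≥ G_{x_c}(0,e₀) ≥ x_c + 2x_c³ + 6x_c⁵ + 28x_c⁷ ≥ 0.5405` (under the quoted bounds
`2.6 ≤ μ ≤ 2.7`, taken as a HYPOTHESIS here so that the theorem is axiom-clean; the tree discharges
them computationally, `LawlerSchrammWerner2004SAW_connectiveConstant_bounds_holds`, see §13). NUMERICS (exp/bubblejob, kit job j006917; exact enumeration of
`c_n(0,e₀)` = 1, 2, 6, 28, 140, 744, 4116, 23504, 137412, 818260, 4945292 for n = 1…21, i.e.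
`p_m` = 1, 2, 7, 28, 124, 588, 2938, 15268, 81826, 449572 ✓ literature): partial sum to `n = 21`
at `x_c = 1/2.63815853` is `0.6559`; the terms decay like `A (n+1)^{-3/2}` (`α = 1/2`), tail
`≈ 0.14`, so `G_{x_c}(0,e₀) ≈ 0.80` (gen-1 estimate `0.81`). A proof must therefore produce a
constant `≥ 0.54`; conjecturally the sharp constant is `≈ 0.8`, and NO finite computation bounds
it from above. [cite: MadrasSlade1993, §1.4] -/
theorem const_ge_of_criticalBubbleBound (hμ : LawlerSchrammWerner2004SAW_connectiveConstant_bounds)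
    {C : ℝ≥0∞}
    (hC : ∀ (Ω : Set ℂ) (δ : ℝ) (u v : Site 2), Bornology.IsBounded Ω → 0 < δ →
      (zdGraph 2).Adj u v → SAW.weight Ω δ u v univ ≤ C) :
    ENNReal.ofReal 0.5405 ≤ C := by
  have hK : bubble e₀ ≤ C := latticeKernel_le_of_forall_unitDisk _ fun δ hδ => by
    rw [weightAt_criticalFugacity]; exact hC unitDisk δ 0 e₀ isBounded_unitDisk hδ adj_zero_e₀
  refine le_trans ?_ (poly_le_bubble.trans hK)
  apply ENNReal.ofReal_le_ofReal
  -- `x_c ≥ 1/2.7` from the quoted `μ ≤ 2.7` (hypothesis; discharged computationally in §13)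
  have hμpos : 0 < connectiveConstant := by linarith [hμ.1]
  have hx : (1 / 2.7 : ℝ) ≤ criticalFugacity := by
    rw [criticalFugacity, ← one_div]
    exact one_div_le_one_div_of_le hμpos hμ.2
  have h0 : (0 : ℝ) ≤ 1 / 2.7 := by norm_num
  have h3 := pow_le_pow_left₀ h0 hx 3
  have h5 := pow_le_pow_left₀ h0 hx 5
  have h7 := pow_le_pow_left₀ h0 hx 7
  have hnum : (0.5405 : ℝ) ≤ 1 / 2.7 + 2 * (1 / 2.7) ^ 3 + 6 * (1 / 2.7) ^ 5 + 28 * (1 / 2.7) ^ 7 := by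
    norm_num
  linarith

/-- Axiom-clean variant (standard axioms only, via the elementary `μ ≤ 3`, `x_c ≥ 1/3`): any
admissible constant is `≥ 1/3 + 2/27 + 6/243 + 28/2187 ≥ 0.4449`. (The `0.5405` version above
inherits `Lean.ofReduceBool` from the certified `μ ≤ 2.7`.) [cite: MadrasSlade1993, §1.2, eq. (1.2.2)] -/
theorem const_ge_of_criticalBubbleBound' {C : ℝ≥0∞}
    (hC : ∀ (Ω : Set ℂ) (δ : ℝ) (u v : Site 2), Bornology.IsBounded Ω → 0 < δ →
      (zdGraph 2).Adj u v → SAW.weight Ω δ u v univ ≤ C) :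
    ENNReal.ofReal 0.4449 ≤ C := by
  have hK : bubble e₀ ≤ C := latticeKernel_le_of_forall_unitDisk _ fun δ hδ => by
    rw [weightAt_criticalFugacity]; exact hC unitDisk δ 0 e₀ isBounded_unitDisk hδ adj_zero_e₀
  refine le_trans ?_ (poly_le_bubble.trans hK)
  apply ENNReal.ofReal_le_ofReal
  have hx : (1 / 3 : ℝ) ≤ criticalFugacity := one_third_le_criticalFugacity
  have h0 : (0 : ℝ) ≤ 1 / 3 := by norm_num
  have h3 := pow_le_pow_left₀ h0 hx 3
  have h5 := pow_le_pow_left₀ h0 hx 5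
  have h7 := pow_le_pow_left₀ h0 hx 7
  have hnum : (0.4449 : ℝ) ≤ 1 / 3 + 2 * (1 / 3) ^ 3 + 6 * (1 / 3) ^ 5 + 28 * (1 / 3) ^ 7 := by
    norm_num
  linarith

/-! ## §12 Parity bookkeeping: only odd lengths contribute to the bubble (`ℤ²` is bipartite) -/

/-- Coordinate-sum parity along a lattice walk: `Σ_i v_i - Σ_i u_i ≡ |p| (mod 2)`. [folklore] -/
theorem walk_parity {u v : Site 2} (p : (zdGraph 2).Walk u v) :
    Even ((v 0 + v 1) - (u 0 + u 1) - (p.length : ℤ)) := by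
  induction p with
  | nil => simp
  | cons hadj q ih =>
    rename_i a b c
    rw [SimpleGraph.Walk.length_cons]
    obtain ⟨i, h | h⟩ := (zdGraph_adj_iff _ _).1 hadj
    · have hb : b 0 + b 1 = a 0 + a 1 + 1 := by
        subst h; fin_cases i <;> simp <;> ring
      have : (c 0 + c 1) - (a 0 + a 1) - ((q.length + 1 : ℕ) : ℤ) =
          ((c 0 + c 1) - (b 0 + b 1) - (q.length : ℤ)) := by push_cast; rw [hb]; ring
      rw [this]; exact ih
    · have ha : a 0 + a 1 = b 0 + b 1 + 1 := by
        subst h; fin_cases i <;> simp <;> ring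
      have : (c 0 + c 1) - (a 0 + a 1) - ((q.length + 1 : ℕ) : ℤ) =
          ((c 0 + c 1) - (b 0 + b 1) - (q.length : ℤ)) - 2 := by push_cast; rw [ha]; ring
      rw [this]; exact ih.sub (by decide)

/-- SAWs `0 → e₀` have ODD length; hence `c_n(0,e₀) = 0` for even `n` and
`G_x(0,e₀) = Σ_{n odd} c_n(0,e₀) x^n` (`= x + 2x³ + 6x⁵ + 28x⁷ + 140x⁹ + …`). [folklore] -/
theorem countAt_e₀_eq_zero_of_even {n : ℕ} (hn : Even n) : Zd.countAt 2 n e₀ = 0 := by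
  classical
  rw [← Zd.card_sawWalksAt, Finset.card_eq_zero, Finset.eq_empty_iff_forall_notMem]
  intro p hp
  have hlen : p.length = n := (Zd.mem_sawWalksAt.1 hp).2
  have hpar : Even ((e₀ 0 + e₀ 1) - ((0 : Site 2) 0 + (0 : Site 2) 1) - (p.length : ℤ)) := walk_parity p
  have h1 : (e₀ 0 + e₀ 1 : ℤ) = 1 := by simp [e₀]
  have h0 : ((0 : Site 2) 0 + (0 : Site 2) 1 : ℤ) = 0 := by simp
  rw [h1, h0, hlen] at hpar
  obtain ⟨k, hk⟩ := hn
  obtain ⟨j, hj⟩ := hpar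
  omega

end Summit.CriticalPhenomena.SAWScalingLimit.Theorems.CriticalBubbleBound.Negative
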